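import Literature.IUT.HodgeArakelov.TemperedThetaMonoidsProofs2
import Literature.IUT.HodgeArakelov.BadPrimeGaussianMonoidsProofs3

/-!
# [IUTchII] Cor 3.5 (ii) "⥤" / Remark 3.5.2: conjugate synchronization of the CONSTANTS is a consequence of
# the natural isomorphism `Ψ_cns(M^Θ_*) ⥲ O^▷` of Prop 3.1 (ii) — proof-only sequel to
# `BadPrimeGaussianMonoidsProofs3.lean`

S. Mochizuki, *Inter-universal Teichmüller theory II*, kurims Dec-2020 manuscript: Cor 3.5 (i)–(ii) pp. 94–95
(conjugate synchronization, the Galois compatibility "⥤"), Remark 3.5.2 pp. 96–99, Prop 3.1 (ii) p. 88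
[cite: Mochizuki2012, Cor 3.5 (ii) p.94]. Claim key DISPUTED (D-0012). PROOF-ONLY (abc-iut cell, layer L6,
seat abc-iut-w4-d004; continuation of DISCHARGE-L6 §F row F1; node IUTchII:Cor3.5(ii), Galois clause).
NO definition, NO `Prop` fact.

`BadPrimeGaussianMonoidsProofs3.map_pi_diagonalStable` proved "each `Ψ_ξ(M^Θ_*)` is equipped with a natural
action by `G_v(M^Θ_*▶)_{⟨F_l^⋇⟩}`" modulo a CONJUGATE-SYNCHRONIZATION hypothesis `hsync`: the `G_v`-actions on
`Ψ^ι_env` obtained through the various inclusions `s_t : G_v ↪ Π_X(M^Θ_*)` (determined by the `D^δ_{t,μ_-}`,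
`t ∈ F_l^⋇`) agree. This file DERIVES the constant part of `hsync` from landed inputs:

* `conj_eq_conj_of_mk_eq` — by the NATURAL (= `Π_X(M^Θ_*)`-equivariant onto the `G_v = Π/Δ`-action) isomorphism
  `Ψ_cns(M^Θ_*) ⥲ O^⊳(G_v(M^Θ_*))` of Prop 3.1 (ii) (abc-iut-w4-d019's `exists_constantMonoid_mulEquiv_Otri`,
  `TemperedThetaMonoidsProofs2.lean`, over the Kummer map `κ` with its two printed properties), two elements
  of `Π_X(M^Θ_*)` with the same image in `G_v(M^Θ_*)` act identically on `Ψ_cns(M^Θ_*)`: the geometric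
  fundamental group `Δ` acts trivially on the constants;
* `sync_constants_of_sections`, `sync_units_of_sections` — hence any family of sections `s_t` that agree
  modulo `Δ` (they are all sections of `Π_X ↠ G_v`) acts label-independently on `Ψ_cns ⊇ M^×_TM`;
* `sync_splitMonoid` — synchronization on `M^×_TM · θ^ℕ` reduces to synchronization on `M^×_TM` and on the one
  class `θ`;
* `splitMonoid_conjStable` — stability of `M^×_TM · θ^ℕ` under an element stabilising `M^×_TM` and moving `θ`
  by a unit; the unit part is abc-iut-w4-d019's `units_conjStable_of_kummer`;
* `map_pi_diagonalStable_of_kummer` — **the diagonal `G_v,⟨F_l^⋇⟩`-stability of the image of `Ψ^ι_env = M^×_TM·θ^ℕ`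
  with the constant half of `hsync` and the stability hypothesis DISCHARGED**: the residual named hypotheses
  are the equivariance of the restrictions along the `s_t` (functoriality of restriction) and two statements
  ON THE SINGLE CLASS `θ` — synchronization `conj (s_t g) θ = conj (s_{t'} g) θ` and `conj (s_t g) θ ∈ M^×_TM · θ`
  (in print: the `D^δ_{t,μ_-}` lie in `Π_Ÿ` (Cor 2.4 (ii)(c)), which acts on the Kummer class of the
  `K̈`-rational function `Θ̈` through `G_v`, by roots of unity; class-level [EtTh] Prop 1.4 content, cf.
  GAP-LEDGER G-w4d010-2); `map_pi_diagonalStable_of_kummer_of_fixed` — the natural special case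
  `conj (s_t g) θ = θ` (inner automorphisms of `Π_Ÿ ⊇ D^δ_{t,μ_-}` fix `η̈^Θ`: L2's `ContH1.conj_eq_self_of_mem`
  for the concrete `H¹`), leaving exactly the equivariance `hr` and `hfix` as named hypotheses.

Nothing here asserts a disputed claim or takes a side on [IUTchIII] Cor 3.12; typed ≠ proved ≠ endorsed.
-/

namespace Literature.IUT.HodgeArakelov

namespace BadPrimeGaussianMonoids

open TemperedThetaMonoids

universe u v w

/-! ### 1. `Δ` acts trivially on the constants (from the natural isomorphism with `O^⊳`) -/

section Constants

variable {S : ThetaSetting.{u}} (A : AbsTopMonoids S) (Pc : IsoClass S.PiX)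
  (E : TemperedThetaMonoids.ThetaEnvData.{u, v} Pc.G) (κ : A.MTM Pc →* E.H)

/-- **IUTchII:Cor3.5(ii)** / **IUTchII:Prop3.1(ii)** (kurims p.94, p.88): two elements of `Π_X(M^Θ_*)` with the
same image in `G_v(M^Θ_*) = Π_X(M^Θ_*)/Δ` act IDENTICALLY on the constant monoid `Ψ_cns(M^Θ_*)` — because the
natural isomorphism `Ψ_cns(M^Θ_*) ⥲ O^⊳(G_v(M^Θ_*))` intertwines the conjugation action with an action of the
quotient (hypotheses = those of abc-iut-w4-d019's `exists_constantMonoid_mulEquiv_Otri`: the Kummer map `κ` is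
injective, has image `Ψ_cns`, and is `Π_X`-equivariant). [cite: Mochizuki2012, Cor 3.5 (ii) p.94] -/
theorem conj_eq_conj_of_mk_eq (hκ : Function.Injective κ) (hcns : E.constantMonoid = MonoidHom.mrange κ)
    (hκeq : ∀ (x : Pc.G) (m : A.MTM Pc), κ (A.actMTM Pc x m) = E.conj x (κ m)) {x x' : Pc.G}
    (h : (QuotientGroup.mk x : Pc.G ⧸ A.Delta Pc) = QuotientGroup.mk x') {c : E.H}
    (hc : c ∈ E.constantMonoid) : E.conj x c = E.conj x' c := by
  obtain ⟨e, -, he⟩ := exists_constantMonoid_mulEquiv_Otri A Pc E κ hκ hcns hκeq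
  have hx := he x ⟨c, hc⟩
  have hx' := he x' ⟨c, hc⟩
  rw [h, ← hx'] at hx
  exact congrArg Subtype.val (e.injective hx)

variable {G : Type w} [Group G] {T : Type*}

/-- **IUTchII:Cor3.5(ii)** (kurims p.94–95) conjugate synchronization of the constants: sections
`s_t : G_v → Π_X(M^Θ_*)` (`t ∈ F_l^⋇`) that agree modulo `Δ` — e.g. any sections of `Π_X ↠ G_v`, such as the
inclusions determined by the decomposition groups `D^δ_{t,μ_-}` — act label-independently on `Ψ_cns(M^Θ_*)`.
[cite: Mochizuki2012, Cor 3.5 (ii) p.94] -/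
theorem sync_constants_of_sections (hκ : Function.Injective κ)
    (hcns : E.constantMonoid = MonoidHom.mrange κ)
    (hκeq : ∀ (x : Pc.G) (m : A.MTM Pc), κ (A.actMTM Pc x m) = E.conj x (κ m)) (s : T → (G →* Pc.G))
    (hs : ∀ t t' g, (QuotientGroup.mk (s t g) : Pc.G ⧸ A.Delta Pc) = QuotientGroup.mk (s t' g))
    (g : G) (t t' : T) (c : E.H) (hc : c ∈ E.constantMonoid) : E.conj (s t g) c = E.conj (s t' g) c :=
  conj_eq_conj_of_mk_eq A Pc E κ hκ hcns hκeq (hs t t' g) hc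

/-- **IUTchII:Cor3.5(ii)** (kurims p.94–95), the same on the unit group `M^×_TM(M^Θ_*) ⊆ Ψ_cns(M^Θ_*)`.
[cite: Mochizuki2012, Cor 3.5 (ii) p.94] -/
theorem sync_units_of_sections (hκ : Function.Injective κ)
    (hcns : E.constantMonoid = MonoidHom.mrange κ)
    (hκeq : ∀ (x : Pc.G) (m : A.MTM Pc), κ (A.actMTM Pc x m) = E.conj x (κ m)) (s : T → (G →* Pc.G))
    (hs : ∀ t t' g, (QuotientGroup.mk (s t g) : Pc.G ⧸ A.Delta Pc) = QuotientGroup.mk (s t' g))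
    (g : G) (t t' : T) (u : E.H) (hu : u ∈ E.units) : E.conj (s t g) u = E.conj (s t' g) u :=
  sync_constants_of_sections A Pc E κ hκ hcns hκeq s hs g t t' u (units_le_constantMonoid E hu)

end Constants

/-! ### 2. Synchronization on `M^×_TM · θ^ℕ` from synchronization on `M^×_TM` and on `θ` -/

section Split

variable {H : Type u} [CommGroup H] {P : Type v} [Group P] {G : Type w} [Group G] {T : Type*}
  (conj : P →* MulAut H) (s : T → (G →* P))

/-- **IUTchII:Cor3.5(ii)** (kurims p.95) bookkeeping: actions through two sections that agree on the units
`M^×_TM` and on the class `θ` agree on the whole theta monoid `M^×_TM · θ^ℕ`.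
[cite: Mochizuki2012, Cor 3.5 (ii) p.95] -/
theorem sync_splitMonoid (U : Subgroup H) (θ : H)
    (hU : ∀ g t t', ∀ u ∈ U, conj (s t g) u = conj (s t' g) u)
    (hθ : ∀ g t t', conj (s t g) θ = conj (s t' g) θ) (g : G) (t t' : T) (x : H)
    (hx : x ∈ splitMonoid U (Submonoid.powers θ)) : conj (s t g) x = conj (s t' g) x := by
  obtain ⟨u, hu, _, ⟨n, rfl⟩, rfl⟩ := (mem_splitMonoid_iff _ _ _).mp hx
  rw [map_mul, map_mul, map_pow, map_pow, hU g t t' u hu, hθ g t t']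

/-- **IUTchII:Cor3.5(ii)** / **Prop3.1(i)** (kurims p.95, p.87) bookkeeping: an element of `Π_X(M^Θ_*)` that
stabilises the units `M^×_TM` and moves the class `θ` within its `M^×_TM`-orbit (in print: by the Kummer class
of a root of unity) stabilises the theta monoid `M^×_TM · θ^ℕ`. [cite: Mochizuki2012, Cor 3.5 (ii) p.95] -/
theorem splitMonoid_conjStable (U : Subgroup H) (θ : H) (p : P) (hU : ∀ u ∈ U, conj p u ∈ U)
    (hθ : ∃ u ∈ U, conj p θ = u * θ) (x : H) (hx : x ∈ splitMonoid U (Submonoid.powers θ)) :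
    conj p x ∈ splitMonoid U (Submonoid.powers θ) := by
  obtain ⟨u, hu, _, ⟨n, rfl⟩, rfl⟩ := (mem_splitMonoid_iff _ _ _).mp hx
  obtain ⟨w, hw, hθw⟩ := hθ
  rw [map_mul, map_pow, hθw, mul_pow, ← mul_assoc]
  exact (mem_splitMonoid_iff _ _ _).mpr
    ⟨conj p u * w ^ n, U.mul_mem (hU u hu) (U.pow_mem hw n), θ ^ n, ⟨n, rfl⟩, rfl⟩

end Split

/-! ### 3. The diagonal `G_v,⟨F_l^⋇⟩`-stability of `Ψ_ξ` with the constant half of `hsync` discharged -/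

section Assembly

variable {S : ThetaSetting.{u}} (A : AbsTopMonoids S) (Pc : IsoClass S.PiX)
  (E : TemperedThetaMonoids.ThetaEnvData.{u, v} Pc.G) (κ : A.MTM Pc →* E.H)
  {G : Type w} [Group G] {T : Type*} {M : Type*} [CommMonoid M]

/-- **IUTchII:Cor3.5(ii)** (kurims p.95) "each `Ψ_ξ(M^Θ_*)` is equipped with a natural action by
`G_v(M^Θ_*▶)_{⟨F_l^⋇⟩}`", for `Ψ^ι_env = M^×_TM · θ^ℕ` (`θ ∈ θ^ι_env` generating the orbit modulo units): the image
under the restrictions `r_t` is stable under the DIAGONAL action, given (a) the Kummer data of Prop 3.1 (ii)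
(as in `TemperedThetaMonoidsProofs2`), (b) sections `s_t : G_v → Π_X(M^Θ_*)` agreeing modulo `Δ`,
(c) restrictions equivariant along the `s_t` and an action `β` on the copies, and two hypotheses on the ONE class
`θ`: (d) synchronization `conj (s_t g) θ = conj (s_{t'} g) θ` and (e) `conj (s_t g) θ ∈ M^×_TM · θ` — the
constant half of conjugate synchronization and the stability of the units being PROVED from (a)
(`sync_units_of_sections`, abc-iut-w4-d019's `units_conjStable_of_kummer`). [cite: Mochizuki2012, Cor 3.5 (ii) p.95] -/
theorem map_pi_diagonalStable_of_kummer (hκ : Function.Injective κ)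
    (hcns : E.constantMonoid = MonoidHom.mrange κ)
    (hκeq : ∀ (x : Pc.G) (m : A.MTM Pc), κ (A.actMTM Pc x m) = E.conj x (κ m)) (s : T → (G →* Pc.G))
    (hs : ∀ t t' g, (QuotientGroup.mk (s t g) : Pc.G ⧸ A.Delta Pc) = QuotientGroup.mk (s t' g))
    (β : G →* MulAut M) (r : T → (E.H →* M)) (hr : ∀ t g x, r t (E.conj (s t g) x) = β g (r t x))
    (θ : E.H) (hθ : ∀ g t t', E.conj (s t g) θ = E.conj (s t' g) θ)
    (hθU : ∀ g t, ∃ u ∈ E.units, E.conj (s t g) θ = u * θ) (t₀ : T) (g : G) :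
    ((splitMonoid E.units (Submonoid.powers θ)).map (MonoidHom.pi r)).map (piIso T (β g)).toMonoidHom =
      (splitMonoid E.units (Submonoid.powers θ)).map (MonoidHom.pi r) :=
  map_pi_diagonalStable E.conj s β r hr _
    (sync_splitMonoid E.conj s E.units θ (sync_units_of_sections A Pc E κ hκ hcns hκeq s hs) hθ)
    (fun g t => splitMonoid_conjStable E.conj E.units θ (s t g)
      (fun u hu => units_conjStable_of_kummer A Pc E κ hcns hκeq (s t g) u hu) (hθU g t)) t₀ g

/-- **IUTchII:Cor3.5(ii)** (kurims p.95), the same with the `θ`-hypotheses in their natural form: the elements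
`s_t(g) ∈ D^δ_{t,μ_-}` FIX the class `θ` — in print because `D^δ_{t,μ_-} ⊆ Π_Ÿ(M^Θ_*)` (Cor 2.4 (ii)(c); typed
`TwoTorsionTranslates.Dtmu_le`) and inner automorphisms of `Π_Ÿ` act trivially on `H¹(Π_Ÿ, −)` (classical; in
the tree for the concrete `H¹`: `Literature.AnabelianGeometry.EtaleTheta.ContH1.conj_eq_self_of_mem`); over the
abstract module `ThetaEnvData.H` this is the one residual named hypothesis `hfix` besides the equivariance `hr`.
[cite: Mochizuki2012, Cor 3.5 (ii) p.95] -/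
theorem map_pi_diagonalStable_of_kummer_of_fixed (hκ : Function.Injective κ)
    (hcns : E.constantMonoid = MonoidHom.mrange κ)
    (hκeq : ∀ (x : Pc.G) (m : A.MTM Pc), κ (A.actMTM Pc x m) = E.conj x (κ m)) (s : T → (G →* Pc.G))
    (hs : ∀ t t' g, (QuotientGroup.mk (s t g) : Pc.G ⧸ A.Delta Pc) = QuotientGroup.mk (s t' g))
    (β : G →* MulAut M) (r : T → (E.H →* M)) (hr : ∀ t g x, r t (E.conj (s t g) x) = β g (r t x))
    (θ : E.H) (hfix : ∀ g t, E.conj (s t g) θ = θ) (t₀ : T) (g : G) :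
    ((splitMonoid E.units (Submonoid.powers θ)).map (MonoidHom.pi r)).map (piIso T (β g)).toMonoidHom =
      (splitMonoid E.units (Submonoid.powers θ)).map (MonoidHom.pi r) :=
  map_pi_diagonalStable_of_kummer A Pc E κ hκ hcns hκeq s hs β r hr θ
    (fun g t t' => by rw [hfix, hfix]) (fun g t => ⟨1, E.units.one_mem, by rw [hfix, one_mul]⟩) t₀ g

end Assembly

end BadPrimeGaussianMonoids

end Literature.IUT.HodgeArakelov
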